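/-
Copyright (c) 2026 the pub-hodgecm-mathlib formalisation cell (harness21).  Prover seat hodgecm-mathlib-F0P3a-p02 (g19): LH3 «Transf» road,
brick (WALL-CONT) (dealer LH3-plan (g3) rulings #2 2026-09-02; consumer LH7-p02 (g2), (I₃-TRANSF) ED. 2).
-/
import Literature.Analysis.Calculus.SmoothGluingAcrossHyperplaneRay
import HarnessLib

/-!
# One-sided jet limits are continuous along the wall

Sequel of the `SmoothGluingAcrossHyperplane` kit (everything PROVED; no definition, no named fact, no `sorry`).  ONE side of a hyperplane
wall: `U` open, `f` `C^∞` on `U ∩ {a < ℓ}` with the `(n+1)`-st jet bounded there near every wall point.  Then (mean value inequality on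
convex half-balls, ★ `exists_tendsto_iteratedFDeriv_of_bound`) the `n`-th jet has a limit from the side `{a < ℓ}` at every wall point, and
the field `g := extendFrom (U ∩ {a < ℓ}) Dⁿf` — `= Dⁿf` on the open side, `=` the one-sided limit on the wall — is CONTINUOUS on the CLOSED
side `U ∩ {a ≤ ℓ}` (`exists_continuousOn_oneSided_iteratedFDeriv`); in particular the one-sided limit along ANY transversal ray
`x + t•v` (`0 < ℓ v`, `t → 0⁺`) is `g x`, a continuous function of the wall point `x`.  Mirror statement for the side `{ℓ < a}` and
`t → 0⁻` (`…_lt`).  This is A. Bouaziz, *Intégrales orbitales sur les groupes de Lie réductifs*, Ann. Sci. ÉNS 27 (1994), §3.2 p. 579: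
«(I₁) et le lemme 1-3-21 de [V] impliquent que, si F est une composante connexe de H ∩ U_reg et si u ∈ S(𝔥_ℂ), la fonction ∂(u)ψ_H se
prolonge par continuité à l'adhérence de F.  Cela justifie l'existence des limites dans la propriété (I₃)» — used to propagate jump
identities (I₃) from the semiregular points of a wall (where both sides are continuous in the wall point) to all of it by density.

## References
* A. Bouaziz, *Intégrales orbitales sur les groupes de Lie réductifs*, Ann. Sci. ÉNS (4) 27 (1994), §3.2 (I₁), (I₃) pp. 579–580.
* D. Shelstad, *Characters and inner forms of a quasi-split group over `ℝ`*, Compositio Math. 39 (1979), §4 Prop. 4.5 p. 26.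
-/

noncomputable section

open Set Filter Metric Function
open scoped Topology NNReal ContDiff

namespace Literature.Analysis.Calculus

variable {E : Type*} [NormedAddCommGroup E] [NormedSpace ℝ E]
  {F : Type*} [NormedAddCommGroup F] [NormedSpace ℝ F] [CompleteSpace F]

section WallCont

variable (ℓ : E →L[ℝ] ℝ) (a : ℝ)

/-- **ONE-SIDED JET LIMITS ARE CONTINUOUS ALONG THE WALL (side `{a < ℓ}`, ray `t → 0⁺`).**  `U` open, `f` `C^∞` on `U ∩ {a < ℓ}`, the
`(n+1)`-st jet bounded on that side near every wall point of `U`.  Then `g := extendFrom (U ∩ {a < ℓ}) (Dⁿf)` is continuous on the closed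
side `U ∩ {a ≤ ℓ}`, equals `Dⁿf` on the open side, is the limit of `Dⁿf` from the side `{a < ℓ}` at every wall point, and is the limit of
`Dⁿf` along every transversal ray `x + t • v`, `0 < ℓ v`, `t → 0⁺`. [cite: Bouaziz1994IntegralesOrbitales, §3.2 (I₁) p. 579] -/
theorem exists_continuousOn_oneSided_iteratedFDeriv {v : E} (hv : 0 < ℓ v) {U : Set E} (hU : IsOpen U) {f : E → F}
    (hf : ContDiffOn ℝ ∞ f (U ∩ {y | a < ℓ y})) {n : ℕ}
    (hb : ∀ x ∈ U, ℓ x = a → ∃ C : ℝ, ∀ᶠ y in 𝓝 x, a < ℓ y → ‖iteratedFDeriv ℝ (n + 1) f y‖ ≤ C) :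
    ∃ g : E → E [×n]→L[ℝ] F, ContinuousOn g (U ∩ {y | a ≤ ℓ y}) ∧ EqOn g (iteratedFDeriv ℝ n f) (U ∩ {y | a < ℓ y}) ∧
      ∀ x ∈ U, ℓ x = a →
        Tendsto (iteratedFDeriv ℝ n f) (𝓝[{y | a < ℓ y}] x) (𝓝 (g x)) ∧
        Tendsto (fun t : ℝ => iteratedFDeriv ℝ n f (x + t • v)) (𝓝[>] 0) (𝓝 (g x)) := by
  set s : Set E := U ∩ {y | a < ℓ y} with hsdef
  have hs : IsOpen s := hU.inter (isOpen_setOf_lt_apply ℓ a)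
  have hcont : ContinuousOn (iteratedFDeriv ℝ n f) s :=
    (hf.continuousOn_iteratedFDerivWithin (m := n) (by exact_mod_cast le_top) hs.uniqueDiffOn).congr
      fun z hz => (iteratedFDerivWithin_of_isOpen n hs hz).symm
  -- limits within `s` exist at every point of the closed side
  have hlim : ∀ y ∈ U ∩ {y | a ≤ ℓ y}, ∃ l, Tendsto (iteratedFDeriv ℝ n f) (𝓝[s] y) (𝓝 l) := by
    rintro y ⟨hyU, hya⟩
    rcases (show a ≤ ℓ y from hya).lt_or_eq with h | h
    · exact ⟨_, hcont y ⟨hyU, h⟩⟩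
    · -- wall point: a ball on which the `(n+1)`-st jet is bounded off the wall
      obtain ⟨C, hC⟩ := hb y hyU h.symm
      obtain ⟨r, hr, hB⟩ := Metric.eventually_nhds_iff_ball.1 (hC.and (hU.eventually_mem hyU))
      set A : Set E := ball y r ∩ {z | a < ℓ z} with hAdef
      have hAs : A ⊆ s := fun z hz => ⟨(hB z hz.1).2, hz.2⟩
      have hAc : Convex ℝ A := (convex_ball y r).inter (convex_setOf_lt_apply ℓ a)
      obtain ⟨l, hl⟩ := exists_tendsto_iteratedFDeriv_of_bound (m := n) hs hAc hAs hf (fun z hz => (hB z hz.1).1 hz.2)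
        (mem_closure_inter_lt_apply h.symm hv (ball_mem_nhds y hr))
      refine ⟨l, ?_⟩
      have e1 : 𝓝[A] y = 𝓝[{z | a < ℓ z}] y := nhdsWithin_inter_eq_of_isOpen isOpen_ball (mem_ball_self hr)
      have e2 : 𝓝[s] y = 𝓝[{z | a < ℓ z}] y := nhdsWithin_inter_eq_of_isOpen hU hyU
      rwa [e1, ← e2] at hl
  have hcl : U ∩ {y | a ≤ ℓ y} ⊆ closure s := by
    rintro y ⟨hyU, hya⟩
    rcases (show a ≤ ℓ y from hya).lt_or_eq with h | h
    · exact subset_closure ⟨hyU, h⟩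
    · exact mem_closure_inter_lt_apply h.symm hv (hU.mem_nhds hyU)
  refine ⟨extendFrom s (iteratedFDeriv ℝ n f), continuousOn_extendFrom hcl hlim,
    fun y hy => extendFrom_extends hcont y hy, fun x hxU hxa => ?_⟩
  have h1 : Tendsto (iteratedFDeriv ℝ n f) (𝓝[s] x) (𝓝 (extendFrom s (iteratedFDeriv ℝ n f) x)) :=
    tendsto_extendFrom (hlim x ⟨hxU, le_of_eq hxa.symm⟩)
  have e2 : 𝓝[s] x = 𝓝[{z | a < ℓ z}] x := nhdsWithin_inter_eq_of_isOpen hU hxU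
  rw [e2] at h1
  refine ⟨h1, h1.comp ?_⟩
  simpa [univ_inter] using tendsto_ray_nhdsWithin_lt_apply hxa hv univ_mem

/-- **ONE-SIDED JET LIMITS ARE CONTINUOUS ALONG THE WALL (side `{ℓ < a}`, ray `t → 0⁻`)** — the mirror statement, same transversal
`v` with `0 < ℓ v`. [cite: Bouaziz1994IntegralesOrbitales, §3.2 (I₁) p. 579] -/
theorem exists_continuousOn_oneSided_iteratedFDeriv_lt {v : E} (hv : 0 < ℓ v) {U : Set E} (hU : IsOpen U) {f : E → F}
    (hf : ContDiffOn ℝ ∞ f (U ∩ {y | ℓ y < a})) {n : ℕ}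
    (hb : ∀ x ∈ U, ℓ x = a → ∃ C : ℝ, ∀ᶠ y in 𝓝 x, ℓ y < a → ‖iteratedFDeriv ℝ (n + 1) f y‖ ≤ C) :
    ∃ g : E → E [×n]→L[ℝ] F, ContinuousOn g (U ∩ {y | ℓ y ≤ a}) ∧ EqOn g (iteratedFDeriv ℝ n f) (U ∩ {y | ℓ y < a}) ∧
      ∀ x ∈ U, ℓ x = a →
        Tendsto (iteratedFDeriv ℝ n f) (𝓝[{y | ℓ y < a}] x) (𝓝 (g x)) ∧
        Tendsto (fun t : ℝ => iteratedFDeriv ℝ n f (x + t • v)) (𝓝[<] 0) (𝓝 (g x)) := by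
  -- apply the previous statement to `-ℓ`, `-a`, `-v`
  have hv' : 0 < (-ℓ) (-v) := by simpa using hv
  have hset1 : {y : E | -a < (-ℓ) y} = {y | ℓ y < a} := by ext y; simp [neg_lt_neg_iff]
  have hset2 : {y : E | -a ≤ (-ℓ) y} = {y | ℓ y ≤ a} := by ext y; simp [neg_le_neg_iff]
  have hb' : ∀ x ∈ U, (-ℓ) x = -a → ∃ C : ℝ, ∀ᶠ y in 𝓝 x, -a < (-ℓ) y → ‖iteratedFDeriv ℝ (n + 1) f y‖ ≤ C := by
    intro x hxU hxa
    obtain ⟨C, hC⟩ := hb x hxU (by simpa [neg_inj] using hxa)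
    exact ⟨C, hC.mono fun y hy hya => hy (by simpa [neg_lt_neg_iff] using hya)⟩
  obtain ⟨g, hgc, hge, hgl⟩ := exists_continuousOn_oneSided_iteratedFDeriv (-ℓ) (-a) hv' hU (f := f) (by rwa [hset1]) (n := n) hb'
  rw [hset1] at hge hgl
  rw [hset2] at hgc
  refine ⟨g, hgc, hge, fun x hxU hxa => ?_⟩
  obtain ⟨h1, h2⟩ := hgl x hxU (by simpa [neg_inj] using hxa)
  exact ⟨h1, (tendsto_ray_neg_iff (iteratedFDeriv ℝ n f) x v _).1 h2⟩

/-- **TWO-SIDED PACKAGE**: `f` `C^∞` off the wall with every jet bounded near the wall points (the `hb` of ★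
`contDiffOn_extendFrom_of_oneSidedLimits_eq`) ⇒ for each order `n` two fields `g₊`, `g₋`, continuous on the respective CLOSED sides, equal
to `Dⁿf` on the open sides, and giving the two one-sided ray limits at every wall point.  (So a jump identity `g₊ x − g₋ x = J x` with `J`
continuous along the wall propagates from a dense set of wall points to all of them.) [cite: Bouaziz1994IntegralesOrbitales, §3.2 (I₁)–(I₃) pp. 579–580] -/
theorem exists_continuousOn_oneSided_iteratedFDeriv_pair {v : E} (hv : 0 < ℓ v) {U : Set E} (hU : IsOpen U) {f : E → F}
    (hf : ContDiffOn ℝ ∞ f (U ∩ {y | ℓ y ≠ a})) (n : ℕ)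
    (hb : ∀ x ∈ U, ℓ x = a → ∃ C : ℝ, ∀ᶠ y in 𝓝 x, ℓ y ≠ a → ‖iteratedFDeriv ℝ (n + 1) f y‖ ≤ C) :
    ∃ gp gm : E → E [×n]→L[ℝ] F,
      ContinuousOn gp (U ∩ {y | a ≤ ℓ y}) ∧ ContinuousOn gm (U ∩ {y | ℓ y ≤ a}) ∧
      EqOn gp (iteratedFDeriv ℝ n f) (U ∩ {y | a < ℓ y}) ∧ EqOn gm (iteratedFDeriv ℝ n f) (U ∩ {y | ℓ y < a}) ∧
      ∀ x ∈ U, ℓ x = a →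
        Tendsto (fun t : ℝ => iteratedFDeriv ℝ n f (x + t • v)) (𝓝[>] 0) (𝓝 (gp x)) ∧
        Tendsto (fun t : ℝ => iteratedFDeriv ℝ n f (x + t • v)) (𝓝[<] 0) (𝓝 (gm x)) := by
  have hfp : ContDiffOn ℝ ∞ f (U ∩ {y | a < ℓ y}) := hf.mono fun y hy => ⟨hy.1, ne_of_gt hy.2⟩
  have hfm : ContDiffOn ℝ ∞ f (U ∩ {y | ℓ y < a}) := hf.mono fun y hy => ⟨hy.1, ne_of_lt hy.2⟩
  have hbp : ∀ x ∈ U, ℓ x = a → ∃ C : ℝ, ∀ᶠ y in 𝓝 x, a < ℓ y → ‖iteratedFDeriv ℝ (n + 1) f y‖ ≤ C := fun x hx hxa =>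
    (hb x hx hxa).imp fun C hC => hC.mono fun y hy hya => hy (ne_of_gt hya)
  have hbm : ∀ x ∈ U, ℓ x = a → ∃ C : ℝ, ∀ᶠ y in 𝓝 x, ℓ y < a → ‖iteratedFDeriv ℝ (n + 1) f y‖ ≤ C := fun x hx hxa =>
    (hb x hx hxa).imp fun C hC => hC.mono fun y hy hya => hy (ne_of_lt hya)
  obtain ⟨gp, hgpc, hgpe, hgpl⟩ := exists_continuousOn_oneSided_iteratedFDeriv ℓ a hv hU hfp (n := n) hbp
  obtain ⟨gm, hgmc, hgme, hgml⟩ := exists_continuousOn_oneSided_iteratedFDeriv_lt ℓ a hv hU hfm (n := n) hbm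
  exact ⟨gp, gm, hgpc, hgmc, hgpe, hgme, fun x hx hxa => ⟨(hgpl x hx hxa).2, (hgml x hx hxa).2⟩⟩

end WallCont

end Literature.Analysis.Calculus
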